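import Mathlib

/-!
# SoloBlindThreeSquaresPlane — the 2-adic criterion behind the rank-16 census (COROLLARY W′ / PROPOSITION R6)

Context (solo-blind census of the `T₈ = U² ⊕ D₄(-1)` face, work/s47/sheets.md §4, §8).  A Picard-rank-16
curve `Z` of the face with algebraic plane `N_Z ≅ ⟨-a,-b⟩` (`a, b > 0`) has transcendental space
`T_Z ≅ U² ⊕ ⟨x,y⟩` ("Lombardo shape", the case covered by Floccari's Kuga–Satake theorem) if and only if the
binary form `⟨a,b⟩` embeds isometrically into `I₄ = ⟨1,1,1,1⟩` over `ℚ`, if and only if `-ab` is not a square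
in `ℚ₂`.  The arithmetic heart of the last equivalence is certified here over `ℤ`:

* `euler` : for `v w : ℤ⁴`, `|v|²·|w|² = (v·w)² + q₁² + q₂² + q₃²` (Euler's identity, i.e. `N(v̄w)`), so for
  `v ⊥ w` the product of the two norms is a sum of THREE squares (`plane_product_three_squares`);
* `not_three_squares` : no integer of the form `4^k (8m+7)` is a sum of three integer squares (the mod-8
  obstruction plus 2-descent), hence
* `plane_obstruction` : two orthogonal integer vectors in `ℤ⁴` never have `|v|²·|w|² = 4^k (8m+7)`; in
  particular `⟨1,7⟩ ⊄ I₄` (`no_plane_one_seven`), the example quoted in COROLLARY W′;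
* `rot_orth`, `rot_nsq`, `plane_nn` : the quaternion rotation `v ↦ v·i` shows `⟨n,n⟩ ⊂ I₄` for every
  `n = |v|²`, i.e. (Lagrange) for every `n ≥ 0` — the case `N = ⟨-n,-n⟩` of the boundary stratum `W₋₁`;
* `plane_three_three`, `plane_three_six`, `plane_one_two` : the explicit embeddings quoted in R6.

Only the integral statements are formalised; the passage to `ℚ` (Davenport–Cassels / Hasse–Minkowski) and
the lattice-theoretic translation are on paper (sheets.md §8).  No `sorry`, no new axioms.
-/

namespace Summit.HodgeConjecture.HodgeConjecture.Theorems.ThreeSquaresPlane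

/-- The standard dot product on `ℤ⁴`, written out in coordinates. -/
def dot (v w : Fin 4 → ℤ) : ℤ := v 0 * w 0 + v 1 * w 1 + v 2 * w 2 + v 3 * w 3

/-- The squared norm `|v|² = v·v`. -/
def nsq (v : Fin 4 → ℤ) : ℤ := dot v v

/-- First imaginary component of the quaternion product `v̄ w`. -/
def q1 (v w : Fin 4 → ℤ) : ℤ := v 0 * w 1 - v 1 * w 0 + v 2 * w 3 - v 3 * w 2

/-- Second imaginary component of the quaternion product `v̄ w`. -/
def q2 (v w : Fin 4 → ℤ) : ℤ := v 0 * w 2 - v 1 * w 3 - v 2 * w 0 + v 3 * w 1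

/-- Third imaginary component of the quaternion product `v̄ w`. -/
def q3 (v w : Fin 4 → ℤ) : ℤ := v 0 * w 3 + v 1 * w 2 - v 2 * w 1 - v 3 * w 0

/-- Euler's four-square identity in the form `|v|²|w|² = (v·w)² + q₁² + q₂² + q₃²`. -/
theorem euler (v w : Fin 4 → ℤ) :
    nsq v * nsq w = dot v w ^ 2 + q1 v w ^ 2 + q2 v w ^ 2 + q3 v w ^ 2 := by
  unfold nsq dot q1 q2 q3; ring

/-- For orthogonal `v, w ∈ ℤ⁴` the product of the norms is a sum of three integer squares. -/
theorem plane_product_three_squares (v w : Fin 4 → ℤ) (h : dot v w = 0) :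
    ∃ x y z : ℤ, nsq v * nsq w = x ^ 2 + y ^ 2 + z ^ 2 :=
  ⟨q1 v w, q2 v w, q3 v w, by rw [euler, h]; ring⟩

/-- Squares mod 8: a sum of three squares is never `7 (mod 8)`. -/
theorem mod8_obstruction : ∀ a b c : ZMod 8, a ^ 2 + b ^ 2 + c ^ 2 ≠ 7 := by decide

/-- Squares mod 4: if a sum of three squares vanishes mod 4, each summand is `0` or `2` mod 4. -/
theorem mod4_descent : ∀ a b c : ZMod 4, a ^ 2 + b ^ 2 + c ^ 2 = 0 →
    (a = 0 ∨ a = 2) ∧ (b = 0 ∨ b = 2) ∧ (c = 0 ∨ c = 2) := by decide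

/-- An integer whose class mod 4 is `0` or `2` is even. -/
theorem even_of_zmod4 (x : ℤ) (h : (x : ZMod 4) = 0 ∨ (x : ZMod 4) = 2) : 2 ∣ x := by
  rcases h with h | h
  · have h4 : (4 : ℤ) ∣ x := (ZMod.intCast_zmod_eq_zero_iff_dvd x 4).mp h
    exact dvd_trans ⟨2, by norm_num⟩ h4
  · have h' : (x : ZMod 4) = ((2 : ℤ) : ZMod 4) := by rw [h]; norm_cast
    have h4 : (4 : ℤ) ∣ x - 2 := by
      have := (ZMod.intCast_eq_intCast_iff_dvd_sub 2 x 4).mp h'.symm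
      simpa using this
    obtain ⟨t, ht⟩ := h4
    exact ⟨2 * t + 1, by omega⟩

/-- Legendre's obstruction: `4^k (8m+7)` is never a sum of three integer squares. -/
theorem not_three_squares : ∀ (k : ℕ) (m x y z : ℤ), x ^ 2 + y ^ 2 + z ^ 2 ≠ 4 ^ k * (8 * m + 7) := by
  intro k
  induction k with
  | zero =>
    intro m x y z h
    have h8 : ((x : ZMod 8)) ^ 2 + ((y : ZMod 8)) ^ 2 + ((z : ZMod 8)) ^ 2 = 7 := by
      have := congrArg (Int.cast : ℤ → ZMod 8) h
      push_cast at this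
      have e8 : (8 : ZMod 8) = 0 := by decide
      rw [e8] at this
      simpa using this
    exact mod8_obstruction _ _ _ h8
  | succ k ih =>
    intro m x y z h
    have hsum4 : (4 : ℤ) ∣ x ^ 2 + y ^ 2 + z ^ 2 := by
      rw [h, pow_succ]; exact ⟨4 ^ k * (8 * m + 7), by ring⟩
    have hz : ((x : ZMod 4)) ^ 2 + ((y : ZMod 4)) ^ 2 + ((z : ZMod 4)) ^ 2 = 0 := by
      have := (ZMod.intCast_zmod_eq_zero_iff_dvd (x ^ 2 + y ^ 2 + z ^ 2) 4).mpr hsum4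
      push_cast at this
      exact this
    obtain ⟨hx, hy, hz'⟩ := mod4_descent _ _ _ hz
    obtain ⟨a, rfl⟩ := even_of_zmod4 x hx
    obtain ⟨b, rfl⟩ := even_of_zmod4 y hy
    obtain ⟨c, rfl⟩ := even_of_zmod4 z hz'
    have h4 : (4 : ℤ) * (a ^ 2 + b ^ 2 + c ^ 2) = 4 * (4 ^ k * (8 * m + 7)) := by
      calc (4 : ℤ) * (a ^ 2 + b ^ 2 + c ^ 2) = (2 * a) ^ 2 + (2 * b) ^ 2 + (2 * c) ^ 2 := by ring
        _ = 4 ^ (k + 1) * (8 * m + 7) := h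
        _ = 4 * (4 ^ k * (8 * m + 7)) := by ring
    exact ih m a b c (mul_left_cancel₀ (by norm_num : (4 : ℤ) ≠ 0) h4)

/-- The plane obstruction: orthogonal `v, w ∈ ℤ⁴` never have `|v|²|w|² = 4^k (8m+7)`; over `ℚ` this is the
statement `⟨a,b⟩ ⊂ ⟨1,1,1,1⟩ ⇒ -ab ∉ (ℚ₂^×)²` of PROPOSITION R6. -/
theorem plane_obstruction (v w : Fin 4 → ℤ) (h : dot v w = 0) (k : ℕ) (m : ℤ) :
    nsq v * nsq w ≠ 4 ^ k * (8 * m + 7) := by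
  rw [euler, h]
  simpa using not_three_squares k m (q1 v w) (q2 v w) (q3 v w)

/-- The example of COROLLARY W′: no orthogonal integer vectors of norms `1` and `7` in `ℤ⁴`
(`⟨1,7⟩ ⊄ I₄`; Gauss: `7` is not a sum of three squares). -/
theorem no_plane_one_seven (v w : Fin 4 → ℤ) (h : dot v w = 0) : ¬ (nsq v = 1 ∧ nsq w = 7) := by
  rintro ⟨hv, hw⟩
  have := plane_obstruction v w h 0 0
  rw [hv, hw] at this
  norm_num at this

/-- Right multiplication by the quaternion `i`: `(v₀,v₁,v₂,v₃) ↦ (-v₁,v₀,-v₃,v₂)`. -/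
def rot (v : Fin 4 → ℤ) : Fin 4 → ℤ := ![-(v 1), v 0, -(v 3), v 2]

/-- `v·i` is orthogonal to `v`. -/
theorem rot_orth (v : Fin 4 → ℤ) : dot v (rot v) = 0 := by
  unfold dot rot; simp; ring

/-- `v·i` has the same norm as `v`. -/
theorem rot_nsq (v : Fin 4 → ℤ) : nsq (rot v) = nsq v := by
  unfold nsq dot rot; simp; ring

/-- `⟨n,n⟩ ⊂ I₄` for every `n = |v|²` (hence, by Lagrange, for every `n ≥ 0`): the binary form of the
boundary stratum `W₋₁` (`N = ⟨-n,-n⟩`) always embeds, on every sheet. -/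
theorem plane_nn (v : Fin 4 → ℤ) : ∃ w : Fin 4 → ℤ, dot v w = 0 ∧ nsq w = nsq v :=
  ⟨rot v, rot_orth v, rot_nsq v⟩

/-- Explicit embedding `⟨3,3⟩ ⊂ I₄`: `(1,1,1,0) ⊥ (1,-1,0,1)`. -/
theorem plane_three_three :
    dot ![1, 1, 1, 0] ![1, -1, 0, 1] = 0 ∧ nsq ![1, 1, 1, 0] = 3 ∧ nsq ![1, -1, 0, 1] = 3 := by
  unfold nsq dot; simp

/-- Explicit embedding `⟨3,6⟩ ⊂ I₄`: `(1,1,1,0) ⊥ (1,-1,0,2)`. -/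
theorem plane_three_six :
    dot ![1, 1, 1, 0] ![1, -1, 0, 2] = 0 ∧ nsq ![1, 1, 1, 0] = 3 ∧ nsq ![1, -1, 0, 2] = 6 := by
  unfold nsq dot; simp

/-- Explicit embedding `⟨1,2⟩ ⊂ I₄`: `(1,0,0,0) ⊥ (0,1,1,0)`. -/
theorem plane_one_two :
    dot ![1, 0, 0, 0] ![0, 1, 1, 0] = 0 ∧ nsq ![1, 0, 0, 0] = 1 ∧ nsq ![0, 1, 1, 0] = 2 := by
  unfold nsq dot; simp

end Summit.HodgeConjecture.HodgeConjecture.Theorems.ThreeSquaresPlane
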